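/-
Copyright (c) 2026 the pub-hodgecm-mathlib formalisation cell (harness21).  Prover seat hodgecm-mathlib-K2Liu-p12 (g0): Track B «K2-LIT»,
#184♮ = hLiu418 = stmt-HodgeConjecture-24832; Road Φ of socket #41, organ Φ5 «bad finite places» (LEAD F0P6-plan (g13) rulings «M-157c∕h»), file F4b-1.
-/
import Summits.HodgeConjecture.HodgeConjecture.Theorems.K2LiuBadPlaceWhittakerShells      -- ★ F4a: `setIntegral_shell_eq_zero_of_levi`
import Summits.HodgeConjecture.HodgeConjecture.Theorems.K2LiuLocalLeviSupply              -- ★ F3a: `exists_ball_levi_supply`, `exists_continuousAddEquiv_levi_conj`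
import Summits.HodgeConjecture.HodgeConjecture.Theorems.K2LiuWhittakerCharacterMoves       -- ★ F3c-2 (+ ★ F3c-1): factorisation, negligibility, boxes, covering
import Literature.NumberTheory.Automorphic.AdicCompletionCompact                           -- ★ `𝒪_w` is open
import HarnessLib

/-!
# Crux `HLiu418`, Road Φ of socket #41, organ Φ5 — FILE F4b-1: THE FAR SHELLS OF THE BAD-PLACE WHITTAKER INTEGRAL VANISH (assembly)

Cell `hodgecm-mathlib`, crux item hLiu418 = `stmt-HodgeConjecture-24832`, route of record `HCCMUnconditional`; squad K2 ∕ K2Liu, road `K2_Liu`,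
socket #41 `sig_K2LiuSiegelEisensteinContinuation`, Road Φ, organ Φ5 (spec `K2/K2Liu-p12/g0/SPEC-PHI5-F3-LeviSupplyAndCovering.K2Liu-p12-g0.md` §F4b).
THEOREMS ONLY (no `def`, no `instance`, no `notation`, no named-fact hypothesis, no `sorry`); lane `--supports stmt-HodgeConjecture-24832`
(count-neutral helper; closes no socket by itself).

THE THEOREM (`setIntegral_farShell_eq_zero`, Karel's lemma at a bad finite place, [Casselman1980, §3], [KudlaRallis1994, §2], [Shimura1997, §18]).
Frame: ★ D10 `H(F_v)`, `S = Skew` (★ p01 realisation `hS`), additive Haar `μ` on `S`, a uniformizer `π` of `F_v` and the balls of record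
`B a = {t : S | ∀ i j w, Valued.v (t.1 i j w) ≤ Valued.v (toPlace v w π) ^ a}` (★ F3c-1 letter, ruling M-157h), shells `Sh k = B(−k) ∖ B(−k+1)`.
Data: a family `f s` of Siegel sections of `I_v(s, χ_v)` (★ D1), all right-invariant under one OPEN subgroup `U` (the smoothness group of a `K_v`-finite
section), `χ_w` with open kernels; an additive character `ψ_v` of conductor exponent `d`; the trace-type functional `τ` (`ι_v(τ r) = r + σ r`, `F_v`-linear,
continuous); a `T`-skew Fourier index `β` with `β β⁻ = 1`, `β ∈ ball(−b)`, `β⁻ ∈ ball(−b′)` (`det β ≠ 0`!); the anti-invariant integral `ε` and the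
exponents `c_ε`, `c₂` (`ϖ^{c_ε} ∣ 2ε`, `ϖ^{c₂} ∣ 2`), `b_T` (`T^{±1} ∈ ball(−b_T)`).  Lattice facts (★ F3b by shape, hypotheses `hBm hBfin hB0 hpre`: measurability,
finiteness and positivity of the balls, and their invariance under conjugation by INTEGRAL Levi blocks) and regularity of the pull-back `t ↦ f s (w_Δ n(t))`
(`hφm hφC`).  CONCLUSION: there is `K₁` (independent of `β` and of `s`) such that for every `k ≥ K₁ + 4b + 2b′` and every `s`
`∫_{Sh k} f s (w_Δ n(t)) · ψ_v(−τ(tr(β t))) dμ(t) = 0`.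
PROOF = ★ F4a `setIntegral_shell_eq_zero_of_levi` fed with: the Levi supply of ★ F3a for the `2n²` directions `u = single a b 1`, `single a b ε`
(radius `J₀`), the integrality of `(1 + ẑu)^{∓1}`, `(1 + ẑu′)^{∓1}` for small `z` (continuity, ★ F3a `continuousAt_inv_one_add_smul`; radius `J₁`), the
conjugations `L` of ★ F3a and their lattice invariance (`hpre`), and the three β-dependent clauses of ★ F3c-2 (`whittakerChar_levi_conj` +
`addChar_quadratic_term_eq_one`, `linear_coeff_sub_mem`, `mball_of_forall_coeff_mem`) at the radius `j := d + k − 1 − c_ε − c₂ − b′`.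

## References
* [Casselman1980] W. Casselman, *The unramified principal series of p-adic groups I*, Compositio Math. 40 (1980), §3.
* [KudlaRallis1994] S. Kudla, S. Rallis, Ann. of Math. 140 (1994), §2.   * [Shimura1997] G. Shimura, CBMS 93 (1997), §18.
* [HarrisKudlaSweet1996] M. Harris, S. Kudla, W. J. Sweet, J. AMS 9 (1996): §1 (1.11)–(1.15).
-/

set_option autoImplicit false
-- the mandated namespace repeats the single-problem summit's segment (`HodgeConjecture.HodgeConjecture`)
set_option linter.dupNamespace false

noncomputable section

open scoped NNReal ENNReal Matrix Topology
open NumberField IsDedekindDomain Matrix MeasureTheory Set Filter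
open Literature.NumberTheory.Automorphic Literature.NumberTheory.Automorphic.UnitaryGroup
open Literature.NumberTheory.GelbartRogawski1991.AdaptedBlocks
open Literature.NumberTheory.GelbartRogawski1991.UnitaryDualPair.LocalSplitting
open Literature.NumberTheory.K2Lit.LocalSiegelDoubled
open Summit.HodgeConjecture.HodgeConjecture.Cruxes.HLiu418.K2LiuSiegelLeviWeylAlgebra
open Summit.HodgeConjecture.HodgeConjecture.Cruxes.HLiu418.K2LiuShellVanishingByAveraging
open Summit.HodgeConjecture.HodgeConjecture.Cruxes.HLiu418.K2LiuBadPlaceWhittakerShells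
open Summit.HodgeConjecture.HodgeConjecture.Cruxes.HLiu418.K2LiuLocalLeviSupply
open Summit.HodgeConjecture.HodgeConjecture.Cruxes.HLiu418.K2LiuLocalRingValuationBalls
open Summit.HodgeConjecture.HodgeConjecture.Cruxes.HLiu418.K2LiuWhittakerCharacterMoves

namespace Summit.HodgeConjecture.HodgeConjecture.Cruxes.HLiu418.K2LiuBadPlaceWhittakerFarShells

variable (F : Type) [Field F] [NumberField F] (E : Type) [Field E] [NumberField E] [Algebra F E]
  [Algebra.IsQuadraticExtension F E] (c : E ≃ₐ[F] E)
  {δ : E} (hcδ : c δ = -δ) (hδ : δ ≠ 0) {dd : F} (hd : δ * δ = algebraMap F E dd)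
  (v : HeightOneSpectrum (𝓞 F)) (n : ℕ) {T₀ : Matrix (Fin n) (Fin n) F} (hT₀ : T₀.IsSymm) (hT₀d : IsUnit T₀.det)
  {JD : Matrix (Fin (n + n)) (Fin (n + n)) E} (hJD : JD = (gramD F n T₀).map (algebraMap F E))
  {π : v.adicCompletion F} (hπ : Valued.v π = WithZero.exp (-1 : ℤ))

/-! ## §1 Small tools -/

omit [NumberField F] [Algebra.IsQuadraticExtension F E] in
/-- the unit ball `{v ≤ 1}` of `E_w` is a neighbourhood of each of its points (`𝒪_w` is open). [cite: Casselman1980, §3] -/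
theorem setOf_valued_le_one_mem_nhds (w : PlacesOver E v) {x : w.1.adicCompletion E} (hx : Valued.v x ≤ 1) :
    {y : w.1.adicCompletion E | Valued.v y ≤ 1} ∈ 𝓝 x := by
  have hopen : IsOpen ((w.1.adicCompletionIntegers E : Set (w.1.adicCompletion E))) := Valued.isOpen_valuationSubring _
  have heq : ((w.1.adicCompletionIntegers E : Set (w.1.adicCompletion E))) = {y | Valued.v y ≤ 1} :=
    Set.ext fun y => HeightOneSpectrum.mem_adicCompletionIntegers (K := E) (v := w.1)
  rw [← heq]
  exact hopen.mem_nhds ((HeightOneSpectrum.mem_adicCompletionIntegers (K := E) (v := w.1)).2 hx)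

omit [Algebra.IsQuadraticExtension F E] in
/-- **integrality of `(1 + ẑu)⁻¹` for small `z`** (continuity at `z = 0`, ★ F3a `continuousAt_inv_one_add_smul`; no determinant algebra).
[cite: Casselman1980, §3] -/
theorem eventually_mball_zero_inv_one_add_smul (u : Matrix (Fin n) (Fin n) (LocalRing E v)) :
    ∀ᶠ z in 𝓝 (0 : v.adicCompletion F), ∀ i j (w : PlacesOver E v),
      Valued.v ((1 + toLocalRing E v z • u)⁻¹ i j w) ≤ Valued.v (toPlace v w π) ^ (0 : ℤ) := by
  have hc := continuousAt_inv_one_add_smul F E v n u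
  have h0 : (1 + toLocalRing E v (0 : v.adicCompletion F) • u)⁻¹ = (1 : Matrix (Fin n) (Fin n) (LocalRing E v)) := by
    rw [map_zero, zero_smul, add_zero, inv_one]
  refine eventually_all.2 fun i => eventually_all.2 fun j => eventually_all.2 fun w => ?_
  have hev : Continuous fun X : Matrix (Fin n) (Fin n) (LocalRing E v) => X i j w := (continuous_apply w).comp (continuous_id.matrix_elem i j)
  have hcij : ContinuousAt (fun z : v.adicCompletion F => (1 + toLocalRing E v z • u)⁻¹ i j w) 0 := hev.continuousAt.comp hc
  have hval : Valued.v ((1 + toLocalRing E v (0 : v.adicCompletion F) • u)⁻¹ i j w) ≤ 1 := by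
    rw [h0]; simpa only [zpow_zero] using mball_one F E v (m := Fin n) (π := π) i j w
  filter_upwards [hcij.preimage_mem_nhds (setOf_valued_le_one_mem_nhds F E v w hval)] with z hz
  rw [zpow_zero]; exact hz

omit [NumberField F] [Algebra.IsQuadraticExtension F E] in
/-- the inverse of a conjugation `t ↦ A t D′` is `t ↦ A′ t D″` (`A′A = 1`, `D′D″ = 1`). [cite: HarrisKudlaSweet1996, §1 (1.12)] -/
theorem symm_apply_eq_of_apply_eq {S : AddSubgroup (Matrix (Fin n) (Fin n) (LocalRing E v))} (L : S ≃ₜ+ S)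
    {A D' A' D'' : Matrix (Fin n) (Fin n) (LocalRing E v)} (hL : ∀ t : S, (L t).1 = A * t.1 * D') (hA : A' * A = 1) (hD : D' * D'' = 1) (t : S) :
    (L.symm t).1 = A' * t.1 * D'' := by
  have h := hL (L.symm t)
  rw [ContinuousAddEquiv.apply_symm_apply] at h
  calc (L.symm t).1 = A' * A * (L.symm t).1 * (D' * D'') := by rw [hA, hD, Matrix.one_mul, Matrix.mul_one]
    _ = A' * (A * (L.symm t).1 * D') * D'' := by simp only [Matrix.mul_assoc]
    _ = A' * t.1 * D'' := by rw [← h]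

omit [Algebra.IsQuadraticExtension F E] in
/-- `single a b e` lies in the ball `0` for `e` integral. [cite: Casselman1980, §3] -/
theorem mball_single {e : LocalRing E v} (he : ∀ w : PlacesOver E v, Valued.v (e w) ≤ 1) (a b : Fin n) :
    ∀ i j (w : PlacesOver E v), Valued.v (Matrix.single a b e i j w) ≤ Valued.v (toPlace v w π) ^ (0 : ℤ) := by
  intro i j w
  rw [zpow_zero]
  by_cases h : a = i ∧ b = j
  · obtain ⟨rfl, rfl⟩ := h; rw [Matrix.single_apply_same]; exact he w
  · rw [Matrix.single_apply_of_ne a b e i j h, Pi.zero_apply, map_zero]; exact zero_le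

/-- bookkeeping in `𝔭_v^m`: if `a − b ∈ 𝔭^m` then `−a ∈ 𝔭^m ↔ −b ∈ 𝔭^m`. [cite: Casselman1980, §3] -/
theorem neg_mem_primePowBall_iff_of_sub_mem {m : ℤ} {a b : v.adicCompletion F} (h : a - b ∈ primePowBall (v.adicCompletion F) m) :
    -a ∈ primePowBall (v.adicCompletion F) m ↔ -b ∈ primePowBall (v.adicCompletion F) m := by
  constructor
  · intro ha
    have : -b = -a + (a - b) := by ring
    rw [this]; exact add_mem_primePowBall ha h
  · intro hb
    have : -a = -b + -(a - b) := by ring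
    rw [this]; exact add_mem_primePowBall hb (neg_mem_primePowBall h)

/-! ## §2 The far shells vanish -/

include hcδ hδ hd hT₀ hT₀d hJD hπ in
/-- **THE FAR SHELLS OF THE BAD-PLACE WHITTAKER INTEGRAL VANISH** (Karel's lemma for the Siegel parabolic of `H(F_v)`; see the module docstring
for the data).  There is `K₁`, independent of the Fourier index and of `s`, such that for every `T`-skew `β` with `β β⁻ = 1`, `β ∈ ball(−b)`,
`β⁻ ∈ ball(−b′)` (`0 ≤ b, b′`, `2b_T ≤ b`), every `k ≥ K₁ + 4b + 2b′` and every `s`: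
`∫_{B(−k) ∖ B(−k+1)} f s (w_Δ n(t)) · ψ_v(−τ(tr(β t))) dμ(t) = 0`. [cite: Casselman1980, §3] [cite: KudlaRallis1994, §2] [cite: Shimura1997, §18] -/
theorem setIntegral_farShell_eq_zero
    (S : AddSubgroup (Matrix (Fin n) (Fin n) (LocalRing E v)))
    (hS : ∀ t, t ∈ S ↔ (t.map (conjLocal E c v))ᵀ * gramS F E v n T₀ + gramS F E v n T₀ * t = 0)
    [MeasurableSpace S] [BorelSpace S] [LocallyCompactSpace S] (μ : Measure S) [μ.IsAddHaarMeasure] [μ.Regular]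
    [MeasurableSpace (v.adicCompletion F)] [BorelSpace (v.adicCompletion F)] (μF : Measure (v.adicCompletion F)) [μF.IsAddHaarMeasure]
    -- the section family, its smoothness group, the characters `χ_w`
    {χv : ∀ w : PlacesOver E v, (w.1.adicCompletion E)ˣ →* ℂˣ}
    (hχv : ∀ w : PlacesOver E v, ∃ V ∈ 𝓝 (1 : w.1.adicCompletion E), ∀ x ∈ V, ∀ hx : IsUnit x, χv w hx.unit = 1)
    {U : Subgroup (UnitaryGroup.localPi E c (n + n) JD v)} (hU : IsOpen (U : Set (UnitaryGroup.localPi E c (n + n) JD v)))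
    {f : ℂ → UnitaryGroup.localPi E c (n + n) JD v → ℂ} (hf : ∀ s, IsLocalSiegelSection F E c hcδ hδ hd v n hT₀ hJD χv s (f s))
    (hfU : ∀ s g k, k ∈ U → f s (g * k) = f s g)
    (hφm : ∀ s, Measurable fun t : S => f s (weylDelta F E c v n hJD * nElem F E c v n hJD t.1 ((hS t.1).1 t.2)))
    (hφC : ∀ s (k : ℤ), ∃ C : ℝ, ∀ t : S, (∀ i j (w : PlacesOver E v), Valued.v (t.1 i j w) ≤ Valued.v (toPlace v w π) ^ (-k)) →
      ‖f s (weylDelta F E c v n hJD * nElem F E c v n hJD t.1 ((hS t.1).1 t.2))‖ ≤ C)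
    -- the additive character and the trace-type functional
    {ψ : AddChar (v.adicCompletion F) Circle} (hψ : Continuous ψ) {d : ℤ} (hdψ : ψ.HasConductorExp d)
    {τ : LocalRing E v → v.adicCompletion F} (hτ : ∀ r, toLocalRing E v (τ r) = r + conjLocal E c v r) (hτadd : ∀ r s, τ (r + s) = τ r + τ s)
    (hτs : ∀ (z : v.adicCompletion F) (r : LocalRing E v), τ (toLocalRing E v z * r) = z * τ r) (hτc : Continuous τ)
    -- the anti-invariant integral element and the constants
    {ε : LocalRing E v} (hεσ : conjLocal E c v ε = -ε) (hεint : ∀ w : PlacesOver E v, Valued.v (ε w) ≤ 1) {cε c₂ bT : ℤ}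
    (hε : ∀ w : PlacesOver E v, Valued.v (toPlace v w π) ^ cε ≤ Valued.v ((2 * ε) w))
    (h2 : ∀ w : PlacesOver E v, Valued.v (toPlace v w π) ^ c₂ ≤ Valued.v ((2 : LocalRing E v) w))
    (hTb : ∀ i j (w : PlacesOver E v), Valued.v (gramS F E v n T₀ i j w) ≤ Valued.v (toPlace v w π) ^ (-bT))
    (hTib : ∀ i j (w : PlacesOver E v), Valued.v ((gramS F E v n T₀)⁻¹ i j w) ≤ Valued.v (toPlace v w π) ^ (-bT))
    -- lattice facts (★ F3b by shape)
    (hBm : ∀ a : ℤ, MeasurableSet {t : S | ∀ i j (w : PlacesOver E v), Valued.v (t.1 i j w) ≤ Valued.v (toPlace v w π) ^ a})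
    (hBfin : ∀ a : ℤ, μ {t : S | ∀ i j (w : PlacesOver E v), Valued.v (t.1 i j w) ≤ Valued.v (toPlace v w π) ^ a} ≠ ∞)
    (hB0 : μ {t : S | ∀ i j (w : PlacesOver E v), Valued.v (t.1 i j w) ≤ Valued.v (toPlace v w π) ^ (0 : ℤ)} ≠ 0)
    (hpre : ∀ (L : S ≃ₜ+ S) (A D' A' D'' : Matrix (Fin n) (Fin n) (LocalRing E v)), (∀ t : S, (L t).1 = A * t.1 * D') →
      (∀ t : S, (L.symm t).1 = A' * t.1 * D'') →
      (∀ i j (w : PlacesOver E v), Valued.v (A i j w) ≤ Valued.v (toPlace v w π) ^ (0 : ℤ)) →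
      (∀ i j (w : PlacesOver E v), Valued.v (D' i j w) ≤ Valued.v (toPlace v w π) ^ (0 : ℤ)) →
      (∀ i j (w : PlacesOver E v), Valued.v (A' i j w) ≤ Valued.v (toPlace v w π) ^ (0 : ℤ)) →
      (∀ i j (w : PlacesOver E v), Valued.v (D'' i j w) ≤ Valued.v (toPlace v w π) ^ (0 : ℤ)) →
      ∀ a : ℤ, L ⁻¹' {t : S | ∀ i j (w : PlacesOver E v), Valued.v (t.1 i j w) ≤ Valued.v (toPlace v w π) ^ a} =
        {t : S | ∀ i j (w : PlacesOver E v), Valued.v (t.1 i j w) ≤ Valued.v (toPlace v w π) ^ a}) :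
    ∃ K₁ : ℤ, ∀ (b b' : ℤ) (β βinv : Matrix (Fin n) (Fin n) (LocalRing E v)), 0 ≤ b → 0 ≤ b' → 2 * bT ≤ b →
      (β.map (conjLocal E c v))ᵀ * gramS F E v n T₀ + gramS F E v n T₀ * β = 0 → β * βinv = 1 →
      (∀ i j (w : PlacesOver E v), Valued.v (β i j w) ≤ Valued.v (toPlace v w π) ^ (-b)) →
      (∀ i j (w : PlacesOver E v), Valued.v (βinv i j w) ≤ Valued.v (toPlace v w π) ^ (-b')) →
      ∀ k : ℤ, K₁ + 4 * b + 2 * b' ≤ k → ∀ s : ℂ,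
        ∫ t in {t : S | ∀ i j (w : PlacesOver E v), Valued.v (t.1 i j w) ≤ Valued.v (toPlace v w π) ^ (-k)} \
            {t : S | ∀ i j (w : PlacesOver E v), Valued.v (t.1 i j w) ≤ Valued.v (toPlace v w π) ^ (-k + 1)},
          f s (weylDelta F E c v n hJD * nElem F E c v n hJD t.1 ((hS t.1).1 t.2)) * ((ψ (-τ (Matrix.trace (β * t.1))) : Circle) : ℂ) ∂μ = 0 := by
  classical
  -- abbreviations
  set T : Matrix (Fin n) (Fin n) (LocalRing E v) := gramS F E v n T₀ with hTdef
  have hT : IsUnit T.det := isUnit_det_gramS' F E v n hT₀d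
  have hTt : Tᵀ = T := gramS_transpose F E v n hT₀
  -- the directions `u i` and their Levi twists `u′ i`
  let ι := (Fin n × Fin n) × Bool
  let uu : ι → Matrix (Fin n) (Fin n) (LocalRing E v) := fun i => Matrix.single i.1.1 i.1.2 (if i.2 then ε else 1)
  let uu' : ι → Matrix (Fin n) (Fin n) (LocalRing E v) := fun i => T⁻¹ * ((uu i).map (conjLocal E c v))ᵀ * T
  have hesc : ∀ bb : Bool, ∀ w : PlacesOver E v, Valued.v ((if bb then ε else (1 : LocalRing E v)) w) ≤ 1 := by
    intro bb w; cases bb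
    · simp only [Bool.false_eq_true, ↓reduceIte, Pi.one_apply, map_one, le_refl]
    · exact hεint w
  have huu0 : ∀ i, ∀ a b (w : PlacesOver E v), Valued.v (uu i a b w) ≤ Valued.v (toPlace v w π) ^ (0 : ℤ) := fun i =>
    mball_single F E v n (hesc i.2) i.1.1 i.1.2
  have huu' : ∀ i, ∀ a b (w : PlacesOver E v), Valued.v (uu' i a b w) ≤ Valued.v (toPlace v w π) ^ (-(2 * bT)) := by
    intro i
    have h := mball_mul F E v hπ (mball_mul F E v hπ hTib (mball_conjTranspose F E c v (huu0 i))) hTb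
    intro a b w; rw [show -(2 * bT) = -bT + 0 + -bT by ring]; exact h a b w
  -- (1) Levi supply radius `J₀`
  choose j₀ hj₀ using fun i : ι => exists_ball_levi_supply F E c hcδ hδ hd v n hT₀ hT₀d hJD (uu i) hU χv hχv
  -- (2) integrality radius `J₁` for `(1 + ẑ u)⁻¹`, `(1 + ẑ u′)⁻¹`
  have hJ₁ : ∀ i : ι, ∃ j₁ : ℤ, ∀ z ∈ primePowBall (v.adicCompletion F) j₁,
      (∀ a b (w : PlacesOver E v), Valued.v ((1 + toLocalRing E v z • uu i)⁻¹ a b w) ≤ Valued.v (toPlace v w π) ^ (0 : ℤ)) ∧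
      (∀ a b (w : PlacesOver E v), Valued.v ((1 + toLocalRing E v z • uu' i)⁻¹ a b w) ≤ Valued.v (toPlace v w π) ^ (0 : ℤ)) := by
    intro i
    obtain ⟨j₁, hj₁⟩ := exists_primePowBall_subset_of_mem_nhds_zero
      ((eventually_mball_zero_inv_one_add_smul F E v n (uu i)).and (eventually_mball_zero_inv_one_add_smul F E v n (uu' i)))
    exact ⟨j₁, fun z hz => hj₁ hz⟩
  choose j₁ hj₁ using hJ₁
  -- the constant
  refine ⟨(∑ i : ι, |j₀ i|) + (∑ i : ι, |j₁ i|) + |d| + 2 * |cε| + 2 * |c₂| + 2, ?_⟩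
  intro b b' β βinv hb hb' hbTb hβskew hββ hβ hβinv k hk s
  -- the averaging radius
  set j : ℤ := d + k - 1 - cε - c₂ - b' with hjdef
  have hf1 : (0 : ℤ) ≤ ∑ i : ι, |j₀ i| := Finset.sum_nonneg fun i _ => abs_nonneg _
  have hf2 : (0 : ℤ) ≤ ∑ i : ι, |j₁ i| := Finset.sum_nonneg fun i _ => abs_nonneg _
  have hf3 := abs_nonneg d
  have hf4 := abs_nonneg cε
  have hf5 := abs_nonneg c₂
  have hf6 := le_abs_self d
  have hf7 := neg_abs_le d
  have hf8 := le_abs_self cε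
  have hf9 := le_abs_self c₂
  have hJ0i : ∀ i, j₀ i ≤ j := fun i => by
    have h1 : |j₀ i| ≤ ∑ i : ι, |j₀ i| := Finset.single_le_sum (f := fun i => |j₀ i|) (fun i _ => abs_nonneg _) (Finset.mem_univ i)
    have h2 := le_abs_self (j₀ i)
    omega
  have hJ1i : ∀ i, j₁ i ≤ j := fun i => by
    have h1 : |j₁ i| ≤ ∑ i : ι, |j₁ i| := Finset.single_le_sum (f := fun i => |j₁ i|) (fun i _ => abs_nonneg _) (Finset.mem_univ i)
    have h2 := le_abs_self (j₁ i)
    omega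
  have hj0 : 0 ≤ j := by omega
  have hbj : b ≤ j := by omega
  have h2j : k + 4 * b + d ≤ 2 * j := by omega
  have hb2 : ∀ i, ∀ a b₁ (w : PlacesOver E v), Valued.v (uu i a b₁ w) ≤ Valued.v (toPlace v w π) ^ (-b) := fun i =>
    mball_antitone F E v hπ (by omega) (huu0 i)
  have hb2' : ∀ i, ∀ a b₁ (w : PlacesOver E v), Valued.v (uu' i a b₁ w) ≤ Valued.v (toPlace v w π) ^ (-b) := fun i =>
    mball_antitone F E v hπ (by omega) (huu' i)
  -- (3) the moves: Levi elements `q i z` and conjugations `L i z`, with their properties, for `z ∈ 𝔭^j`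
  have hmoves : ∀ (i : ι) (z : v.adicCompletion F), ∃ (q : UnitaryGroup.localPi E c (n + n) JD v) (L : S ≃ₜ+ S),
      z ∈ primePowBall (v.adicCompletion F) j →
        q ∈ U ∧ blkC (matA F E c v n q) = 0 ∧ blkB (matA F E c v n q) = 0 ∧
        chiDet F E c v n χv (weylDelta F E c v n hJD * q * weylDelta F E c v n hJD) = 1 ∧
        absDetDelta F E c v n (weylDelta F E c v n hJD * q * weylDelta F E c v n hJD) = 1 ∧
        (∀ t : S, (L t).1 = blkA (matA F E c v n q) * t.1 * (blkD (matA F E c v n q))⁻¹) ∧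
        blkA (matA F E c v n q) = 1 + toLocalRing E v z • uu i ∧ (blkD (matA F E c v n q))⁻¹ = 1 + toLocalRing E v z • uu' i ∧
        (∀ a : ℤ, L ⁻¹' {t : S | ∀ i j (w : PlacesOver E v), Valued.v (t.1 i j w) ≤ Valued.v (toPlace v w π) ^ a} =
          {t : S | ∀ i j (w : PlacesOver E v), Valued.v (t.1 i j w) ≤ Valued.v (toPlace v w π) ^ a}) := by
    intro i z
    by_cases hz : z ∈ primePowBall (v.adicCompletion F) j
    · obtain ⟨q, hqU, hC, hB, hA, hDinv, hχ, habs⟩ := hj₀ i z (primePowBall_antitone (hJ0i i) hz)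
      have hqS : IsSiegelDelta F E c hcδ hδ hd v n hT₀ hJD q := (isSiegelDelta_iff_blkC_eq_zero F E c hcδ hδ hd v n hT₀ hJD q).2 hC
      obtain ⟨L, hL⟩ := exists_continuousAddEquiv_levi_conj F E c hcδ hδ hd v n hT₀ hJD S hS hqS
      refine ⟨q, L, fun _ => ⟨hqU, hC, hB, hχ, habs, hL, hA, hDinv, ?_⟩⟩
      -- lattice invariance: the four blocks `A`, `D⁻¹`, `A⁻¹`, `D` are integral
      obtain ⟨hAu, hDu⟩ := isUnit_det_blkA_blkD F E c v n hC
      have hz0 : z ∈ primePowBall (v.adicCompletion F) 0 := primePowBall_antitone hj0 hz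
      have hAint : ∀ a b₁ (w : PlacesOver E v), Valued.v (blkA (matA F E c v n q) a b₁ w) ≤ Valued.v (toPlace v w π) ^ (0 : ℤ) := by
        rw [hA]
        have h := mball_add F E v (mball_one F E v (m := Fin n) (π := π))
          (mball_antitone F E v hπ (a := 0) (b := 0 + 0) (by omega) (mball_smul F E v hπ hz0 (huu0 i)))
        exact h
      have hDinvint : ∀ a b₁ (w : PlacesOver E v), Valued.v ((blkD (matA F E c v n q))⁻¹ a b₁ w) ≤ Valued.v (toPlace v w π) ^ (0 : ℤ) := by
        rw [hDinv]
        have hzb : z ∈ primePowBall (v.adicCompletion F) (2 * bT) := primePowBall_antitone (by omega) hz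
        have h := mball_add F E v (mball_one F E v (m := Fin n) (π := π))
          (mball_antitone F E v hπ (a := 0) (b := 2 * bT + -(2 * bT)) (by omega) (mball_smul F E v hπ hzb (huu' i)))
        exact h
      obtain ⟨hAinvint, hDint⟩ := hj₁ i z (primePowBall_antitone (hJ1i i) hz)
      rw [← hA] at hAinvint
      rw [← hDinv, Matrix.nonsing_inv_nonsing_inv _ hDu] at hDint
      have hsymm : ∀ t : S, (L.symm t).1 = (blkA (matA F E c v n q))⁻¹ * t.1 * blkD (matA F E c v n q) :=
        symm_apply_eq_of_apply_eq F E v n L hL (Matrix.nonsing_inv_mul _ hAu) (Matrix.nonsing_inv_mul _ hDu)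
      exact hpre L _ _ _ _ hL hsymm hAint hDinvint hAinvint hDint
    · exact ⟨1, ContinuousAddEquiv.refl S, fun h => absurd h hz⟩
  choose q L hqL using hmoves
  -- (4) feed ★ F4a
  obtain ⟨C, hC⟩ := hφC s k
  have hχcont : Continuous fun t : S => ((ψ (-τ (Matrix.trace (β * t.1))) : Circle) : ℂ) :=
    continuous_subtype_val.comp (hψ.comp (hτc.comp (continuous_const.matrix_mul continuous_subtype_val).matrix_trace).neg)
  have hcc : ∀ i : ι, Continuous fun t : S => -τ (Matrix.trace (β * (uu i * t.1 + t.1 * uu' i))) := fun i =>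
    (hτc.comp (continuous_const.matrix_mul ((continuous_const.matrix_mul continuous_subtype_val).add
      (continuous_subtype_val.matrix_mul continuous_const))).matrix_trace).neg
  have hprops := fun (i : ι) (z : v.adicCompletion F) (hz : z ∈ primePowBall (v.adicCompletion F) j) => hqL i z hz
  refine setIntegral_shell_eq_zero_of_levi F E c hcδ hδ hd v n hT₀ hJD S hS μ (hf s) (hfU s) (hφm s)
    (χ := fun t : S => ((ψ (-τ (Matrix.trace (β * t.1))) : Circle) : ℂ)) hχcont.measurable (fun t => by rw [Circle.norm_coe])
    μF hψ hdψ j ((hBm (-k)).diff (hBm (-k + 1))) (((measure_mono Set.sdiff_subset).trans_lt (lt_top_iff_ne_top.2 (hBfin (-k)))).ne) hB0 (hBfin 0)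
    (C := C) (fun t ht => hC t ht.1) (Finset.univ : Finset ι) q L (fun i t => -τ (Matrix.trace (β * (uu i * t.1 + t.1 * uu' i))))
    (fun i _ => (hcc i).measurable)
    (fun i _ z hz => (hprops i z hz).1) (fun i _ z hz => (hprops i z hz).2.1) (fun i _ z hz => (hprops i z hz).2.2.1)
    (fun i _ z hz => (hprops i z hz).2.2.2.1) (fun i _ z hz => (hprops i z hz).2.2.2.2.1) (fun i _ z hz => (hprops i z hz).2.2.2.2.2.1)
    (fun i _ z hz => (hprops i z hz).2.2.2.2.2.2.2.2 0) (fun i _ z hz => ?_) (fun i _ z hz t ht => ?_) (fun i _ i' _ z hz t ht => ?_)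
    (fun t ht => ?_)
  · -- the shell is preserved
    rw [Set.preimage_sdiff, (hprops i z hz).2.2.2.2.2.2.2.2 (-k), (hprops i z hz).2.2.2.2.2.2.2.2 (-k + 1)]
  · -- the character factorisation on the shell
    obtain ⟨-, -, -, -, -, hLf, hA, hDinv, -⟩ := hprops i z hz
    show ((ψ (-τ (Matrix.trace (β * (L i z t).1))) : Circle) : ℂ) = _
    rw [hLf t, hA, hDinv, whittakerChar_levi_conj F E v ψ hτadd hτs β (uu i) (uu' i) t.1 z,
      addChar_quadratic_term_eq_one F E c v hπ hdψ hτ hb h2j hβ (hb2 i) (hb2' i) ht.1 hz, mul_one]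
  · -- the boxes are permuted
    obtain ⟨-, -, -, -, -, hLf, hA, hDinv, -⟩ := hprops i' z hz
    have hsub := linear_coeff_sub_mem F E c v hπ hτ hτadd hτs hb hbj h2j (u := uu i) (u' := uu' i) (u₁ := uu i') (u₁' := uu' i') hβ
      (hb2 i) (hb2' i) (hb2 i') (hb2' i') ht.1 hz
    show -τ (Matrix.trace (β * (uu i * (L i' z t).1 + (L i' z t).1 * uu' i))) ∈ primePowBall (v.adicCompletion F) (d - j) ↔ _
    rw [hLf t, hA, hDinv]
    exact neg_mem_primePowBall_iff_of_sub_mem F v hsub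
  · -- the covering: a point of the shell has a coefficient outside `𝔭^{d−j}`
    by_contra hall
    push Not at hall
    have hcoef : ∀ a b₁ : Fin n, ∀ e ∈ ({1, ε} : Set (LocalRing E v)),
        τ (Matrix.trace (β * (Matrix.single a b₁ e * t.1 + t.1 * (T⁻¹ * ((Matrix.single a b₁ e).map (conjLocal E c v))ᵀ * T)))) ∈
          primePowBall (v.adicCompletion F) (d - j) := by
      intro a b₁ e he
      rcases he with rfl | rfl
      · have h' := neg_mem_primePowBall (hall ((a, b₁), false) (Finset.mem_univ _))
        rw [neg_neg] at h'
        exact h'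
      · have h' := neg_mem_primePowBall (hall ((a, b₁), true) (Finset.mem_univ _))
        rw [neg_neg] at h'
        exact h'
    have hball := mball_of_forall_coeff_mem F E c v hπ hcδ hδ hτ hτadd hT hTt hεσ hεint hε h2 hββ hβinv hβskew ((hS t.1).1 t.2) hcoef
    apply ht.2
    intro i j' w
    have h := hball i j' w
    rwa [show d - j - cε - c₂ - b' = -k + 1 by omega] at h

end Summit.HodgeConjecture.HodgeConjecture.Cruxes.HLiu418.K2LiuBadPlaceWhittakerFarShells

end
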